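import Summits.ValiantsHypothesis.ValiantsHypothesis.Theorems.KPlusLogSqLawTropicalBBoundarySectorDefs

/-!
# Route «KPlusLogSqLaw», crux `TropicalB` (stmt-ValiantsHypothesis-19771) — the COUNTING CEILING of the boundary-type sector:
# `BoundaryVertexLaw B (2^B)` for every `B`

HONEST FRAMING.  Helper toward the registered stubs of `Cruxes/TropicalB/Lines/birth.lean` (crux
`Summit.ValiantsHypothesis.ValiantsHypothesis.Theses.KPlusLogSqLaw.TropicalB`, item `stmt-ValiantsHypothesis-19771`, route `KPlusLogSqLaw`,
DRAFT; cell `pub-symmetroid`, seat val-sym-trop-p1 g2).  Companion of `…TropicalBBoundarySectorDefs` (p447010: `BoundarySector.pattern`,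
`IsBoundaryDesign`, `BoundaryVertexLaw`, base cases `B = 0, 1`).  It records the COUNTING ceiling of the sector, so that the target handed
to the trop-p2 successor (`BoundaryVertexLaw 2 2`, desk R1474 (a) / R1476 (a)) is visibly a claim BELOW counting:

* `BoundarySector.designRowD_boundary` — a boundary-type design with `B` boundaries has unsigned row bound `(m+1)^{2^B} − 1`: the slope of a
  present term is `Σ_P #{b : pattern (σ b) b = P} · d (lab P)`, a function of the pattern-count vector `(Fin B → Bool) → Fin (m+1)`, and
  slopes strictly increase along a chain;
* `BoundarySector.boundaryVertexLaw_counting` — hence `BoundaryVertexLaw B (2^B)` with constant `1` (vertex-count currency via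
  `card_dominant_le_succ`).
So `BoundaryVertexLaw 2 4` is a theorem (here), `BoundaryVertexLaw 2 3` is the sharp counting form (the count vector sums to `m`; not
spelled out), and `BoundaryVertexLaw 2 2` is the open sector theorem.  Nothing here is in-window; nothing bears on `TropicalB`,
`KPlusLogSqLaw`, `Lifting`, DoorA26 / DoorA34, `MatrixDescartes` (`stmt-ValiantsHypothesis-18050`) or VP ≠ VNP.
-/

-- `Summit.ValiantsHypothesis.ValiantsHypothesis.…` repeats a component by the D-0017 layout
-- (single-conjunct summit), which the `dupNamespace` linter flags; the name is mandated.
set_option linter.dupNamespace false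
set_option autoImplicit false

namespace Summit.ValiantsHypothesis.ValiantsHypothesis.Theorems.KPlusLogSqLaw

open Summit.ValiantsHypothesis.ValiantsHypothesis.Theorems.MatrixDescartes.Negative
open Summit.ValiantsHypothesis.ValiantsHypothesis.Theorems.LacunarySymmetroidMatrixDescartes
open Finset

namespace BoundarySector

variable {m K B : ℕ}

/-- The slope of a present term of a boundary-type design, regrouped by pattern:
`slope = Σ_P #{b : pattern (σ b) b = P} · d (lab P)`. [folklore] -/
theorem slope_eq_sum_patternCount {π ρ : Fin B → Equiv.Perm (Fin m)} {lab : (Fin B → Bool) → Fin K} (d : Fin K → ℕ)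
    {ε : Fin m → Fin m → Fin K → ℤ} (hε : IsBoundaryDesign π ρ lab ε) {q : Equiv.Perm (Fin m) × (Fin m → Fin K)}
    (hq : termSign ε q ≠ 0) :
    TropicalCensus.slope d q =
      ∑ P : Fin B → Bool, ((univ.filter fun b : Fin m => pattern π ρ (q.1 b) b = P).card : ℤ) * (d (lab P) : ℤ) := by
  classical
  rw [slope_eq_of_present d hε hq]
  rw [← sum_fiberwise_of_maps_to (s := (univ : Finset (Fin m))) (t := (univ : Finset (Fin B → Bool)))
    (g := fun b : Fin m => pattern π ρ (q.1 b) b) (fun b _ => mem_univ _)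
    (fun b : Fin m => (d (lab (pattern π ρ (q.1 b) b)) : ℤ))]
  refine sum_congr rfl fun P _ => ?_
  have e : ∑ b ∈ univ.filter (fun b : Fin m => pattern π ρ (q.1 b) b = P), (d (lab (pattern π ρ (q.1 b) b)) : ℤ) =
      ∑ _b ∈ univ.filter (fun b : Fin m => pattern π ρ (q.1 b) b = P), (d (lab P) : ℤ) :=
    sum_congr rfl fun b hb => by rw [(mem_filter.1 hb).2]
  rw [e, sum_const, nsmul_eq_mul]

/-- **Counting ceiling of the boundary sector.**  A boundary-type design with `B` boundaries has unsigned row bound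
`(m+1)^{2^B} − 1`: the pattern-count vector of the chain terms is injective along the chain. [folklore: slope counting] -/
theorem designRowD_boundary (π ρ : Fin B → Equiv.Perm (Fin m)) (lab : (Fin B → Bool) → Fin K) (d : Fin K → ℕ)
    (v ε : Fin m → Fin m → Fin K → ℤ) (hε : IsBoundaryDesign π ρ lab ε) :
    DesignRowD d v ε ((m + 1) ^ (2 ^ B) - 1) := by
  classical
  intro n θ p hθ hdom hne
  have hsm := slope_strictMono_of_chainD d v ε θ p hθ hdom hne
  -- the pattern-count vector of a chain term
  have hcle : ∀ (k : Fin (n + 1)) (P : Fin B → Bool),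
      (univ.filter fun b : Fin m => pattern π ρ ((p k).1 b) b = P).card < m + 1 := fun k P =>
    Nat.lt_succ_of_le ((card_filter_le _ _).trans (by rw [card_univ, Fintype.card_fin]))
  let cnt : Fin (n + 1) → ((Fin B → Bool) → Fin (m + 1)) := fun k P =>
    ⟨(univ.filter fun b : Fin m => pattern π ρ ((p k).1 b) b = P).card, hcle k P⟩
  have hinj : Function.Injective cnt := by
    intro k k' h
    apply hsm.injective
    simp only
    rw [slope_eq_sum_patternCount d hε (hdom k).1, slope_eq_sum_patternCount d hε (hdom k').1]
    refine sum_congr rfl fun P _ => ?_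
    have hP := congrArg (fun f => ((f P : Fin (m + 1)) : ℕ)) h
    simp only [cnt] at hP
    rw [hP]
  have hcard := Fintype.card_le_of_injective cnt hinj
  rw [Fintype.card_fin, Fintype.card_fun, Fintype.card_fun, Fintype.card_bool, Fintype.card_fin, Fintype.card_fin] at hcard
  have hpos : 1 ≤ (m + 1) ^ (2 ^ B) := Nat.one_le_pow _ _ (Nat.succ_pos m)
  omega

/-- **`BoundaryVertexLaw B (2^B)`** with constant `1`: the counting ceiling of the sector in vertex-count currency (the sector theorem
`BoundaryVertexLaw 2 2` handed to the trop-p2 successor is the claim one exponent BELOW the sharp counting form). [folklore] -/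
theorem boundaryVertexLaw_counting (B : ℕ) : BoundaryVertexLaw B (2 ^ B) := by
  classical
  refine ⟨1, fun m K π ρ lab d v ε hε => ?_⟩
  have h := card_dominant_le_succ d v ε (designRowD_boundary π ρ lab d v ε hε)
  have hpos : 1 ≤ (m + 1) ^ (2 ^ B) := Nat.one_le_pow _ _ (Nat.succ_pos m)
  rw [one_mul]
  omega

end BoundarySector

end Summit.ValiantsHypothesis.ValiantsHypothesis.Theorems.KPlusLogSqLaw
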